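import Literature.AlgebraicGeometry.HodgeTheory.FermatHodgeCharacterLocal
import Literature.AlgebraicGeometry.HodgeTheory.FermatShiodaCondition
import HarnessLib

/-!
# Units of `ℤ/pq` for two primes: CRT fibres, parities, and two small character facts — preliminaries of the level-`5q` classification, line `cancel-by-any-claim-lattice`, crux `HodgeFermatVarieties` (stmt-HodgeConjecture-1334)

Preliminary file (everything PROVED, elementary) of lead c3's level-`5q` programme: for a prime `q ≥ 7`
every Hodge sextuple of `ℤ/5q` is three pairs or Aoki's `5`-standard element, hence HC for every Fermat
fourfold `X⁴_{5q}` modulo the printed facts. Contents, for distinct primes `p`, `q` and `N = p q`: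

* §1 `ZMod (p * q)`: the two reductions, CRT injectivity/surjectivity on units, the trichotomy of a non-zero
  residue (unit / level `q` / level `p`), negation and the reductions;
* §2 fibres of `(ℤ/N)ˣ → (ℤ/q)ˣ`: `Fib q b` has `p - 1` elements and is carried bijectively onto
  `(ℤ/p)ˣ` by the other reduction; `-Fib b = Fib (-b)`;
* §3 parity on `(ℤ/f)ˣ`, `f` prime: a function orthogonal to every ODD character is even
  (`even_of_orthogonal_odd`, from the tree's local Fourier lemma `parityPart_mul_eq_of_orthogonal` with
  `d = 1`);
* §4 two numerical character facts: an odd character mod `5` does not take the value `1` at `2`, and a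
  non-trivial character mod `7` does not take the value `1` at `5` (`5` generates `(ℤ/7)ˣ`).

References: [Aoki1983] N. Aoki, Math. Ann. 266 (1983) §§2–3 (criterion and local analysis).
-/

set_option linter.dupNamespace false

noncomputable section

open Finset
open Literature.AlgebraicGeometry.HodgeTheory Literature.AlgebraicGeometry.HodgeTheory.FermatCharacter

namespace Summit.HodgeConjecture.HodgeConjecture.Theorems.CancelByAnyClaimLattice.FiveQ

/-! ### §1 Residues of `ℤ/pq` -/

section TwoPrimes

variable {p q : ℕ} [Fact p.Prime] [Fact q.Prime]

/-- `p q ≠ 0`. [folklore] -/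
instance neZero_mul_primes : NeZero (p * q) :=
  ⟨Nat.mul_ne_zero (Fact.out : p.Prime).ne_zero (Fact.out : q.Prime).ne_zero⟩

/-- Distinct primes are coprime. [folklore] -/
theorem coprime_of_ne (hpq : p ≠ q) : p.Coprime q :=
  (Nat.coprime_primes Fact.out Fact.out).mpr hpq

/-- In the prime field `ℤ/q`, a residue is a unit iff it is non-zero. [folklore] -/
theorem isUnit_iff_ne_zero_prime (x : ZMod q) : IsUnit x ↔ x ≠ 0 := isUnit_iff_ne_zero

/-- **Trichotomy of a non-zero residue mod `pq`**: a unit, or of level `q` (unit mod `q`, zero mod `p`),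
or of level `p` (zero mod `q`, unit mod `p`). [folklore] -/
theorem trichotomy (hpq : p ≠ q) {x : ZMod (p * q)} (hx : x ≠ 0) :
    IsUnit x ∨
      (ZMod.castHom (dvd_mul_right p q) (ZMod p) x = 0 ∧ ZMod.castHom (dvd_mul_left q p) (ZMod q) x ≠ 0) ∨
      (ZMod.castHom (dvd_mul_right p q) (ZMod p) x ≠ 0 ∧ ZMod.castHom (dvd_mul_left q p) (ZMod q) x = 0) := by
  by_cases hp0 : ZMod.castHom (dvd_mul_right p q) (ZMod p) x = 0
  · by_cases hq0 : ZMod.castHom (dvd_mul_left q p) (ZMod q) x = 0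
    · exact absurd (eq_of_cast_eq_of_coprime (coprime_of_ne hpq) (y := 0)
        (by rw [hp0, map_zero]) (by rw [hq0, map_zero])) hx
    · exact Or.inr (Or.inl ⟨hp0, hq0⟩)
  · by_cases hq0 : ZMod.castHom (dvd_mul_left q p) (ZMod q) x = 0
    · exact Or.inr (Or.inr ⟨hp0, hq0⟩)
    · exact Or.inl ((isUnit_iff_of_coprime x).mpr
        ⟨(isUnit_iff_ne_zero_prime _).mpr hp0, (isUnit_iff_ne_zero_prime _).mpr hq0⟩)

/-- A unit of `ℤ/pq` reduces to a non-zero residue mod `q`. [folklore] -/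
theorem cast_ne_zero_of_isUnit {x : ZMod (p * q)} (hx : IsUnit x) :
    ZMod.castHom (dvd_mul_left q p) (ZMod q) x ≠ 0 :=
  (isUnit_iff_ne_zero_prime _).mp ((isUnit_iff_of_coprime x).mp hx).2

/-- A unit of `ℤ/pq` reduces to a non-zero residue mod `p`. [folklore] -/
theorem cast_ne_zero_of_isUnit' {x : ZMod (p * q)} (hx : IsUnit x) :
    ZMod.castHom (dvd_mul_right p q) (ZMod p) x ≠ 0 :=
  (isUnit_iff_ne_zero_prime _).mp ((isUnit_iff_of_coprime x).mp hx).1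

/-- Two residues mod `pq` with the same reductions mod `p` and mod `q` are equal (CRT). [folklore] -/
theorem eq_of_casts_eq (hpq : p ≠ q) {x y : ZMod (p * q)}
    (h₁ : ZMod.castHom (dvd_mul_right p q) (ZMod p) x = ZMod.castHom (dvd_mul_right p q) (ZMod p) y)
    (h₂ : ZMod.castHom (dvd_mul_left q p) (ZMod q) x = ZMod.castHom (dvd_mul_left q p) (ZMod q) y) :
    x = y :=
  eq_of_cast_eq_of_coprime (coprime_of_ne hpq) h₁ h₂

/-- **CRT injectivity on units**: a unit of `ℤ/pq` is determined by its two reductions. [folklore] -/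
theorem units_eq_of_unitsMap_eq (hpq : p ≠ q) {x y : (ZMod (p * q))ˣ}
    (h₁ : ZMod.unitsMap (dvd_mul_right p q) x = ZMod.unitsMap (dvd_mul_right p q) y)
    (h₂ : ZMod.unitsMap (dvd_mul_left q p) x = ZMod.unitsMap (dvd_mul_left q p) y) : x = y := by
  apply Units.ext
  refine eq_of_casts_eq hpq ?_ ?_
  · have h := congrArg Units.val h₁
    rwa [coe_unitsMap, coe_unitsMap] at h
  · have h := congrArg Units.val h₂
    rwa [coe_unitsMap, coe_unitsMap] at h

/-- **CRT surjectivity on units**: every pair of units mod `p` and mod `q` lifts to a unit mod `pq`.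
[folklore] -/
theorem exists_unit_of_unitsMap (hpq : p ≠ q) (a : (ZMod p)ˣ) (b : (ZMod q)ˣ) :
    ∃ x : (ZMod (p * q))ˣ, ZMod.unitsMap (dvd_mul_right p q) x = a ∧ ZMod.unitsMap (dvd_mul_left q p) x = b :=
  exists_unit_crt (coprime_of_ne hpq) a b

/-- Negation commutes with `unitsMap`. [folklore] -/
theorem unitsMap_neg {m d : ℕ} (hd : d ∣ m) (x : (ZMod m)ˣ) : ZMod.unitsMap hd (-x) = -ZMod.unitsMap hd x := by
  apply Units.ext
  rw [Units.val_neg, coe_unitsMap, coe_unitsMap, Units.val_neg, map_neg]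

/-! ### §2 Fibres of the reduction mod `q` on units -/

/-- **Every fibre of `(ℤ/pq)ˣ → (ℤ/q)ˣ` has `p - 1` elements**: the other reduction carries it
bijectively onto `(ℤ/p)ˣ` (CRT). [folklore] -/
theorem card_fibre (hpq : p ≠ q) (b : (ZMod q)ˣ) :
    #(univ.filter fun x : (ZMod (p * q))ˣ ↦ ZMod.unitsMap (dvd_mul_left q p) x = b) = p - 1 := by
  classical
  rw [← ZMod.card_units p, ← Finset.card_univ]
  refine Finset.card_nbij' (fun x ↦ ZMod.unitsMap (dvd_mul_right p q) x)
    (fun a ↦ (exists_unit_of_unitsMap hpq a b).choose) (fun _ _ ↦ by simp) (fun a _ ↦ ?_)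
    (fun x hx ↦ ?_) (fun a _ ↦ ?_)
  · simp only [coe_filter, mem_univ, true_and, Set.mem_setOf_eq]
    exact (exists_unit_of_unitsMap hpq a b).choose_spec.2
  · simp only [coe_filter, mem_univ, true_and, Set.mem_setOf_eq] at hx
    have h := (exists_unit_of_unitsMap hpq (ZMod.unitsMap (dvd_mul_right p q) x) b).choose_spec
    exact units_eq_of_unitsMap_eq hpq h.1 (h.2.trans hx.symm)
  · exact (exists_unit_of_unitsMap hpq a b).choose_spec.1

/-- **Summation over a fibre through the bijection with `(ℤ/p)ˣ`**: for any `φ`,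
`Σ_{x : x̄ = b} φ(x mod p) = Σ_{a : (ℤ/p)ˣ} φ(a)`. [folklore] -/
theorem sum_fibre_eq_sum_units (hpq : p ≠ q) (b : (ZMod q)ˣ) {M : Type*} [AddCommMonoid M]
    (φ : (ZMod p)ˣ → M) :
    ∑ x ∈ univ.filter (fun x : (ZMod (p * q))ˣ ↦ ZMod.unitsMap (dvd_mul_left q p) x = b),
      φ (ZMod.unitsMap (dvd_mul_right p q) x) = ∑ a : (ZMod p)ˣ, φ a := by
  classical
  refine Finset.sum_nbij' (fun x ↦ ZMod.unitsMap (dvd_mul_right p q) x)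
    (fun a ↦ (exists_unit_of_unitsMap hpq a b).choose) (fun _ _ ↦ mem_univ _) (fun a _ ↦ ?_)
    (fun x hx ↦ ?_) (fun a _ ↦ ?_) (fun _ _ ↦ rfl)
  · simp only [mem_filter, mem_univ, true_and]
    exact (exists_unit_of_unitsMap hpq a b).choose_spec.2
  · simp only [mem_filter, mem_univ, true_and] at hx
    have h := (exists_unit_of_unitsMap hpq (ZMod.unitsMap (dvd_mul_right p q) x) b).choose_spec
    exact units_eq_of_unitsMap_eq hpq h.1 (h.2.trans hx.symm)
  · exact (exists_unit_of_unitsMap hpq a b).choose_spec.1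

/-- **Counting inside a fibre through the bijection with `(ℤ/p)ˣ`**: for a predicate `P` on `(ℤ/p)ˣ`,
`#{x : x̄ = b, P (x mod p)} = #{a : (ℤ/p)ˣ, P a}`. [folklore] -/
theorem card_fibre_filter (hpq : p ≠ q) (b : (ZMod q)ˣ) (P : (ZMod p)ˣ → Prop) [DecidablePred P] :
    #(univ.filter fun x : (ZMod (p * q))ˣ ↦
        ZMod.unitsMap (dvd_mul_left q p) x = b ∧ P (ZMod.unitsMap (dvd_mul_right p q) x)) =
      #(univ.filter fun a : (ZMod p)ˣ ↦ P a) := by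
  classical
  rw [Finset.card_eq_sum_ones, Finset.card_eq_sum_ones]
  have h1 : ∑ x ∈ univ.filter (fun x : (ZMod (p * q))ˣ ↦
      ZMod.unitsMap (dvd_mul_left q p) x = b ∧ P (ZMod.unitsMap (dvd_mul_right p q) x)), (1 : ℕ) =
      ∑ x ∈ univ.filter (fun x : (ZMod (p * q))ˣ ↦ ZMod.unitsMap (dvd_mul_left q p) x = b),
        (if P (ZMod.unitsMap (dvd_mul_right p q) x) then 1 else 0) := by
    rw [Finset.sum_ite, Finset.sum_const_zero, add_zero, Finset.filter_filter]
  rw [h1, sum_fibre_eq_sum_units hpq b (fun a ↦ if P a then (1 : ℕ) else 0), Finset.sum_ite,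
    Finset.sum_const_zero, add_zero]

/-! ### §2' The mirror fibres: the reduction mod `p` on units -/

/-- **Every fibre of `(ℤ/pq)ˣ → (ℤ/p)ˣ` has `q - 1` elements** (bijection with `(ℤ/q)ˣ` by the other
reduction). [folklore] -/
theorem card_fibre' (hpq : p ≠ q) (a : (ZMod p)ˣ) :
    #(univ.filter fun x : (ZMod (p * q))ˣ ↦ ZMod.unitsMap (dvd_mul_right p q) x = a) = q - 1 := by
  classical
  rw [← ZMod.card_units q, ← Finset.card_univ]
  refine Finset.card_nbij' (fun x ↦ ZMod.unitsMap (dvd_mul_left q p) x)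
    (fun b ↦ (exists_unit_of_unitsMap hpq a b).choose) (fun _ _ ↦ by simp) (fun b _ ↦ ?_)
    (fun x hx ↦ ?_) (fun b _ ↦ ?_)
  · simp only [coe_filter, mem_univ, true_and, Set.mem_setOf_eq]
    exact (exists_unit_of_unitsMap hpq a b).choose_spec.1
  · simp only [coe_filter, mem_univ, true_and, Set.mem_setOf_eq] at hx
    have h := (exists_unit_of_unitsMap hpq a (ZMod.unitsMap (dvd_mul_left q p) x)).choose_spec
    exact units_eq_of_unitsMap_eq hpq (h.1.trans hx.symm) h.2
  · exact (exists_unit_of_unitsMap hpq a b).choose_spec.2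

/-- **Summation over a mirror fibre through the bijection with `(ℤ/q)ˣ`.** [folklore] -/
theorem sum_fibre_eq_sum_units' (hpq : p ≠ q) (a : (ZMod p)ˣ) {M : Type*} [AddCommMonoid M]
    (φ : (ZMod q)ˣ → M) :
    ∑ x ∈ univ.filter (fun x : (ZMod (p * q))ˣ ↦ ZMod.unitsMap (dvd_mul_right p q) x = a),
      φ (ZMod.unitsMap (dvd_mul_left q p) x) = ∑ b : (ZMod q)ˣ, φ b := by
  classical
  refine Finset.sum_nbij' (fun x ↦ ZMod.unitsMap (dvd_mul_left q p) x)
    (fun b ↦ (exists_unit_of_unitsMap hpq a b).choose) (fun _ _ ↦ mem_univ _) (fun b _ ↦ ?_)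
    (fun x hx ↦ ?_) (fun b _ ↦ ?_) (fun _ _ ↦ rfl)
  · simp only [mem_filter, mem_univ, true_and]
    exact (exists_unit_of_unitsMap hpq a b).choose_spec.1
  · simp only [mem_filter, mem_univ, true_and] at hx
    have h := (exists_unit_of_unitsMap hpq a (ZMod.unitsMap (dvd_mul_left q p) x)).choose_spec
    exact units_eq_of_unitsMap_eq hpq (h.1.trans hx.symm) h.2
  · exact (exists_unit_of_unitsMap hpq a b).choose_spec.2

end TwoPrimes

/-- **The whole unit group is the disjoint union of the fibres**: `Σ_b #{x ∈ S : x̄ = b} = #S` for a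
set `S` of units. [folklore] -/
theorem card_eq_sum_card_fibre {p q : ℕ} [NeZero q] (S : Finset (ZMod (p * q))ˣ) :
    #S = ∑ b : (ZMod q)ˣ, #(S.filter fun x ↦ ZMod.unitsMap (dvd_mul_left q p) x = b) := by
  classical
  rw [← Finset.card_biUnion]
  · congr 1
    ext x
    simp [Finset.mem_biUnion, Finset.mem_filter]
  · intro b _ b' _ hbb'
    rw [Function.onFun, Finset.disjoint_filter]
    exact fun x _ hx hx' ↦ hbb' (hx.symm.trans hx')


/-! ### §3 Parity on `(ℤ/f)ˣ`, `f` prime -/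

/-- **A function on `ℤ/f` orthogonal to every odd character is even on units** (`f` any level; only the
characters that do not factor through `1`, i.e. all non-trivial ones, are needed, and odd characters are
non-trivial): the tree's local Fourier lemma with `d = 1`, `ε = -1` makes `F(x) - F(-x)` invariant under
all units, hence constant, hence (being odd) zero. [cite: Aoki1983, Lemma 4.4] -/
theorem even_of_orthogonal_odd : ∀ {f : ℕ} [NeZero f] (F : ZMod f → ℂ), (∀ χ : DirichletCharacter ℂ f, χ (-1) = -1 → ∑ x : ZMod f, F x * χ x = 0) → ∀ y : (ZMod f)ˣ, F y = F (-(y : ZMod f)) := by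
  intro f _ F horth y
  have key := fun (u : (ZMod f)ˣ) ↦ parityPart_mul_eq_of_orthogonal (one_dvd f) F (ε := -1) (Or.inr rfl)
    (fun χ hχ _ ↦ horth χ hχ) u y (Subsingleton.elim _ _)
  -- with `u = -1`: `F(-y) - F(y) = F(y) - F(-y)`
  have h := key (-1)
  simp only [Units.val_neg, Units.val_one, neg_mul, one_mul, neg_neg] at h
  -- `h : F (-y) + -1 * F y = F y + -1 * F (-y)`
  have : (2 : ℂ) * (F y - F (-(y : ZMod f))) = 0 := by linear_combination -h
  have h2 : (2 : ℂ) ≠ 0 := two_ne_zero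
  have := (mul_eq_zero.mp this).resolve_left h2
  exact sub_eq_zero.mp this

/-! ### §4 Two numerical character facts -/

/-- **An odd character mod `5` does not take the value `1` at `2`**: `χ(2)² = χ(4) = χ(-1) = -1`.
[folklore] -/
theorem char_five_two_ne_one (χ : DirichletCharacter ℂ 5) (hχ : χ (-1) = -1) : χ (2 : ZMod 5) ≠ 1 := by
  intro h
  have h4 : χ (4 : ZMod 5) = 1 := by
    rw [show (4 : ZMod 5) = 2 * 2 by decide, map_mul, h, one_mul]
  rw [show (4 : ZMod 5) = -1 by decide, hχ] at h4
  norm_num at h4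

/-- **A non-trivial character mod `7` does not take the value `1` at `5`**: every unit of `ℤ/7` is a
power of `5`. [folklore] -/
theorem char_seven_five_ne_one (χ : DirichletCharacter ℂ 7) (hχ : χ ≠ 1) : χ (5 : ZMod 7) ≠ 1 := by
  intro h5
  apply hχ
  apply MulChar.ext
  intro u
  rw [MulChar.one_apply_coe]
  -- every unit is a power of `5`
  have hpow : ∀ v : (ZMod 7)ˣ, ∃ k : ℕ, k < 6 ∧ (v : ZMod 7) = 5 ^ k := by decide
  obtain ⟨k, -, hk⟩ := hpow u
  rw [hk, map_pow, h5, one_pow]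

end Summit.HodgeConjecture.HodgeConjecture.Theorems.CancelByAnyClaimLattice.FiveQ
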